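import Summits.ABC.IUTFork.Repair.EvalI06StarGenuine
import Literature.IUT.LogVolume.LogRadiusClosedForm
import HarnessLib

/-!
# IUT REPAIR branch → R-H (D-0079): the I06⋆ DATUM VERDICT at a bad place of genuine pilot data — ALL labels from the TOP label,
# and the [IUTchIV]-regime top-label negative in closed form (sequel of `Repair/EvalI06StarGenuine`, R41 (2)(a) / SEATS «rp-x3 g4 · R41a»)

PROOF-ONLY file (0 definitions, 0 `Prop` facts) of the abc-iut cell (IUT REPAIR branch B / RESCUE sub-cell R-H; seat abc-iut-rp-x3 gen 4).
TAKES NO SIDE on [IUTchIII] Cor. 3.12 or on any author; statements about OUR typed objects (realising pilot ideles in the rescaled completions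
`K_x`, the real log-shell `ℐ_x`); typed ≠ proved; decided-as-typed ≠ decided-in-print.

WHY. H-num-1's column `i06star_datum` is the CONJUNCTION of the cells over the labels `j ∈ 𝔽_l^⋇` at a bad place (NEG ⟸ one NEG cell; POS ⟸
all cells POS), and the BINDING cell is the top label `j = l⋇` (the demand `(j²−1)·ord_x(q)` grows with `j`). This file turns that into two
datum-class deciders per place, BY NAME over `EvalI06StarGenuine` (p456100):
* §1 **`allLabels_mem_of_top_le`** — if the POS window holds AT THE TOP LABEL, `(l⋇² − 1)·ord_x(q) ≤ 2l·e_x·(c − a_{e_x})`, then the cell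
  `t_{q,x} ∈ t_{Θ,j,x}·ℐ_x` holds at EVERY label `j = i+1` (monotonicity in `j`, `ord_x(q) > 0`); tame closed form **`allLabels_mem_iff_top_of_tame`**:
  for `p > 2`, `e_x ≤ p − 2`, ALL cells POS ⟺ `(l⋇² − 1)·ord_x(q) ≤ 2l·(e_x − 1)`.
* §2 **`not_mem_topLabel_of_lt`** — the [IUTchIV]-regime negative in closed form: `8l·e_x·(b_{e_x} + c) < (l − 3)(l + 1)·ord_x(q)` ⟹ the cell
  FAILS at the top label `j = l⋇` (`4(l⋇² − 1) = (l−3)(l+1)`, `l = 2l⋇ + 1`), hence the datum verdict at `x` is NEG (`exists_not_mem_of_lt`).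
* §3 the same AT `pilotDataOfK D K` (realising ideles; `ord_x(q) = e(x|v)·ord_v(q_v)` available through `ordq_pilotDataOfK`).
READING (neutral): per place the table needs ONE inequality at `j = l⋇`; small `l` / mild places are all-POS, the negatives of the [IUTchIV]
regime start from `(l−3)(l+1)·ord_x(q) > 8l·e_x·(b+c)`. No judgement on print. [cite: MochizukiAbsTopIII2015, Def 5.4 (iii) p. 126]
[cite: Mochizuki2012, IUTchI Ex. 3.2 (iv) p. 71; IUTchIV Prop. 1.2 (i), Thm. 1.10] [cite: DupuyHilado2025, §3.3, §3.4]
[claim: Mochizuki2012, status: disputed]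
-/

noncomputable section

open Set Metric Function NumberField IsDedekindDomain
open scoped Pointwise

namespace Summit.ABC.IUTFork.Repair.EvalI06StarGenuineDatum

open Literature.AnabelianGeometry.AbsoluteAnabelian Literature.IUT.LogThetaLattice Literature.IUT.LogVolume
  Summit.ABC.IUTFork.Repair.CandInternal2Real Summit.ABC.IUTFork.Repair.CandInternal2RealLabels
  Summit.ABC.IUTFork.Repair.EvalI06StarGenuine

section Realising

open Thm311 Thm311.Real Cor312 Cor312Vol Cor312Prov

variable {F : Type} [Field F] [NumberField F] (X : PilotData F)
  (t : ∀ (pp : Nat.Primes) (_ : Fin X.lstar) (x : (thetaIndex X).Fibre (.inr pp)),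
    haveI : Fact (pp : ℕ).Prime := ⟨pp.2⟩; kOf X pp.1 x)
  (ht0 : ∀ pp i x, t pp i x ≠ 0)
  (ht : ∀ (pp : Nat.Primes) (i : Fin X.lstar) (x : (thetaIndex X).Fibre (.inr pp)),
    haveI : Fact (pp : ℕ).Prime := ⟨pp.2⟩
    Real.log ‖t pp i x‖ = -(X.thetaPilot i (placeOf X pp.1 x)) * logNorm F (placeOf X pp.1 x) /
      localDegree F (placeOf X pp.1 x))
  (tq : ∀ (pp : Nat.Primes) (x : (thetaIndex X).Fibre (.inr pp)), haveI : Fact (pp : ℕ).Prime := ⟨pp.2⟩; kOf X pp.1 x)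
  (htq0 : ∀ pp x, tq pp x ≠ 0)
  (htq : ∀ (pp : Nat.Primes) (x : (thetaIndex X).Fibre (.inr pp)),
    haveI : Fact (pp : ℕ).Prime := ⟨pp.2⟩
    Real.log ‖tq pp x‖ = -(X.qPilot (placeOf X pp.1 x)) * logNorm F (placeOf X pp.1 x) /
      localDegree F (placeOf X pp.1 x))

/-! ## §1. ALL labels from the TOP label (datum verdict POS) -/

/-- The demand is monotone in the label: `((i+1)² − 1)·ord_x(q) ≤ (l⋇² − 1)·ord_x(q)` for `i+1 ≤ l⋇` at a bad place (`ord_x(q) > 0`). [folklore] -/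
theorem demand_le_top (pp : Nat.Primes) [Fact (pp : ℕ).Prime] (i : Fin X.lstar) (x : (thetaIndex X).Fibre (.inr pp)) (hx : placeOf X pp.1 x ∈ X.S) :
    ((((i : ℕ) : ℝ) + 1) ^ 2 - 1) * (X.ordq (placeOf X pp.1 x) : ℝ) ≤ ((X.lstar : ℝ) ^ 2 - 1) * (X.ordq (placeOf X pp.1 x) : ℝ) := by
  have hord : (0 : ℝ) ≤ (X.ordq (placeOf X pp.1 x) : ℝ) := by exact_mod_cast (X.ordq_pos hx).le
  have hi : ((i : ℕ) : ℝ) + 1 ≤ X.lstar := by exact_mod_cast Nat.succ_le_of_lt i.2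
  have hi0 : (0 : ℝ) ≤ ((i : ℕ) : ℝ) + 1 := by positivity
  have hsq : (((i : ℕ) : ℝ) + 1) ^ 2 ≤ (X.lstar : ℝ) ^ 2 := pow_le_pow_left₀ hi0 hi 2
  exact mul_le_mul_of_nonneg_right (by linarith) hord

include ht0 ht htq0 htq in
/-- **DATUM POS FROM THE TOP LABEL**: if `(l⋇² − 1)·ord_x(q) ≤ 2l·e_x·(c − a_{e_x})` at the bad place `x | p`, then the I06⋆ cell holds at EVERY
label `j = i+1 ∈ 𝔽_l^⋇` there. [cite: MochizukiAbsTopIII2015, Def 5.4 (iii) p. 126] [cite: DupuyHilado2025, §3.4] -/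
theorem allLabels_mem_of_top_le (pp : Nat.Primes) [Fact (pp : ℕ).Prime] (x : (thetaIndex X).Fibre (.inr pp)) (hx : placeOf X pp.1 x ∈ X.S)
    (hle : ((X.lstar : ℝ) ^ 2 - 1) * (X.ordq (placeOf X pp.1 x) : ℝ) ≤
      2 * X.l * ((placeOf X pp.1 x).asIdeal.ramificationIdx ℤ : ℝ) *
        (((if (pp : ℕ) = 2 then 2 else 1 : ℕ) : ℝ) - logRadiusA pp (absRamificationIdx pp (kOf X pp.1 x))))
    (i : Fin X.lstar) : tq pp x ∈ t pp i x • logShell (PadicLogOnUnits.ofUnitLog (pp : ℕ) (kOf X pp.1 x)) :=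
  qIdele_mem_thetaIdele_smul_logShell_of_le X t ht0 ht tq htq0 htq pp i x hx ((demand_le_top X pp i x hx).trans hle)

include ht0 ht htq0 htq in
/-- **DATUM VERDICT, TAME CLOSED FORM**: for `p > 2`, `e_x ≤ p − 2`, ALL the cells at the bad place `x` hold IFF the top one does, i.e. IFF
`(l⋇² − 1)·ord_x(q) ≤ 2l·(e_x − 1)`. [cite: MochizukiAbsTopIII2015, Def 5.4 (iii) p. 126] [cite: DupuyHilado2025, §3.4] -/
theorem allLabels_mem_iff_top_of_tame (pp : Nat.Primes) [Fact (pp : ℕ).Prime] (hp : 2 < (pp : ℕ)) (x : (thetaIndex X).Fibre (.inr pp))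
    (hx : placeOf X pp.1 x ∈ X.S) (he : absRamificationIdx pp (kOf X pp.1 x) ≤ pp - 2) :
    (∀ i : Fin X.lstar, tq pp x ∈ t pp i x • logShell (PadicLogOnUnits.ofUnitLog (pp : ℕ) (kOf X pp.1 x))) ↔
      ((X.lstar : ℤ) ^ 2 - 1) * X.ordq (placeOf X pp.1 x) ≤ 2 * X.l * (((placeOf X pp.1 x).asIdeal.ramificationIdx ℤ : ℤ) - 1) := by
  have h2 := X.two_le_lstar
  let iTop : Fin X.lstar := ⟨X.lstar - 1, by omega⟩
  have htop : (((iTop : ℕ) : ℤ) + 1) = X.lstar := by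
    show (((X.lstar - 1 : ℕ) : ℤ) + 1) = X.lstar
    rw [Nat.cast_sub (by omega)]; push_cast; ring
  constructor
  · intro h
    have hi := (qIdele_mem_thetaIdele_smul_logShell_iff_of_tame X t ht0 ht tq htq0 htq pp hp iTop x hx he).1 (h iTop)
    rwa [htop] at hi
  · intro hle i
    refine (qIdele_mem_thetaIdele_smul_logShell_iff_of_tame X t ht0 ht tq htq0 htq pp hp i x hx he).2 ?_
    have hord : (0 : ℤ) ≤ X.ordq (placeOf X pp.1 x) := (X.ordq_pos hx).le
    have hi : ((i : ℕ) : ℤ) + 1 ≤ X.lstar := by exact_mod_cast Nat.succ_le_of_lt i.2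
    have hi0 : (0 : ℤ) ≤ ((i : ℕ) : ℤ) + 1 := by positivity
    have hsq : (((i : ℕ) : ℤ) + 1) ^ 2 ≤ (X.lstar : ℤ) ^ 2 := pow_le_pow_left₀ hi0 hi 2
    have := mul_le_mul_of_nonneg_right (sub_le_sub_right hsq 1) hord
    linarith

/-! ## §2. The top-label negative in closed form (datum verdict NEG) -/

/-- `4·(l⋇² − 1) = (l − 3)(l + 1)` with `l = 2l⋇ + 1`. [folklore] -/
theorem four_mul_lstar_sq_sub_one : 4 * ((X.lstar : ℝ) ^ 2 - 1) = ((X.l : ℝ) - 3) * (X.l + 1) := by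
  rw [X.l_cast]; ring

include ht0 ht htq0 htq in
/-- **TOP-LABEL NEGATIVE, CLOSED FORM** (the [IUTchIV] regime): at a bad place `x | p`, `8l·e_x·(b_{e_x} + c) < (l − 3)(l + 1)·ord_x(q)` ⟹ the
I06⋆ cell FAILS at the top label `j = l⋇` (index `l⋇ − 1`). [cite: MochizukiAbsTopIII2015, Def 5.4 (iii) p. 126] [cite: DupuyHilado2025, §3.4] -/
theorem not_mem_topLabel_of_lt (pp : Nat.Primes) [Fact (pp : ℕ).Prime] (x : (thetaIndex X).Fibre (.inr pp)) (hx : placeOf X pp.1 x ∈ X.S)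
    (hlt : 8 * X.l * ((placeOf X pp.1 x).asIdeal.ramificationIdx ℤ : ℝ) *
        (logRadiusB pp (absRamificationIdx pp (kOf X pp.1 x)) + ((if (pp : ℕ) = 2 then 2 else 1 : ℕ) : ℝ)) <
      ((X.l : ℝ) - 3) * (X.l + 1) * (X.ordq (placeOf X pp.1 x) : ℝ)) :
    tq pp x ∉ t pp ⟨X.lstar - 1, by have := X.two_le_lstar; omega⟩ x • logShell (PadicLogOnUnits.ofUnitLog (pp : ℕ) (kOf X pp.1 x)) := by
  have h2 := X.two_le_lstar
  refine qIdele_not_mem_thetaIdele_smul_logShell_of_lt X t ht0 ht tq htq0 htq pp ⟨X.lstar - 1, by omega⟩ x hx ?_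
  have htop : (((X.lstar - 1 : ℕ) : ℝ) + 1) = X.lstar := by
    rw [Nat.cast_sub (by omega)]; push_cast; ring
  show 2 * (X.l : ℝ) * _ * _ < ((((X.lstar - 1 : ℕ) : ℝ) + 1) ^ 2 - 1) * _
  rw [htop, ← four_mul_lstar_sq_sub_one X] at *
  rw [htop]
  nlinarith [hlt]

include ht0 ht htq0 htq in
/-- … hence **the datum verdict at `x` is NEG**: some label's cell fails. [cite: MochizukiAbsTopIII2015, Def 5.4 (iii) p. 126] -/
theorem exists_not_mem_of_lt (pp : Nat.Primes) [Fact (pp : ℕ).Prime] (x : (thetaIndex X).Fibre (.inr pp)) (hx : placeOf X pp.1 x ∈ X.S)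
    (hlt : 8 * X.l * ((placeOf X pp.1 x).asIdeal.ramificationIdx ℤ : ℝ) *
        (logRadiusB pp (absRamificationIdx pp (kOf X pp.1 x)) + ((if (pp : ℕ) = 2 then 2 else 1 : ℕ) : ℝ)) <
      ((X.l : ℝ) - 3) * (X.l + 1) * (X.ordq (placeOf X pp.1 x) : ℝ)) :
    ∃ i : Fin X.lstar, tq pp x ∉ t pp i x • logShell (PadicLogOnUnits.ofUnitLog (pp : ℕ) (kOf X pp.1 x)) :=
  ⟨_, not_mem_topLabel_of_lt X t ht0 ht tq htq0 htq pp x hx hlt⟩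

end Realising

/-! ## §3. At print's own `K`-level pilot datum `pilotDataOfK D K` -/

section Genuine

open Thm311 Thm311.Real Cor312 Cor312Vol Cor312Prov Literature.IUT.HodgeTheaters

variable {F K Fbar : Type} [Field F] [NumberField F] [Field K] [NumberField K] [Algebra F K] [Field Fbar]
  [Algebra F Fbar] [Algebra K Fbar] {E : WeierstrassCurve F} [E.IsElliptic] {l : ℕ} {Pb : BadPlacePredicates K}
  (D : InitialThetaData F K Fbar E l Pb)
  (t : ∀ (pp : Nat.Primes) (_ : Fin (pilotDataOfK D K).lstar) (x : (thetaIndex (pilotDataOfK D K)).Fibre (.inr pp)),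
    haveI : Fact (pp : ℕ).Prime := ⟨pp.2⟩; kOf (pilotDataOfK D K) pp.1 x)
  (ht0 : ∀ pp i x, t pp i x ≠ 0)
  (ht : ∀ (pp : Nat.Primes) (i : Fin (pilotDataOfK D K).lstar) (x : (thetaIndex (pilotDataOfK D K)).Fibre (.inr pp)),
    haveI : Fact (pp : ℕ).Prime := ⟨pp.2⟩
    Real.log ‖t pp i x‖ = -((pilotDataOfK D K).thetaPilot i (placeOf (pilotDataOfK D K) pp.1 x)) *
      logNorm K (placeOf (pilotDataOfK D K) pp.1 x) / localDegree K (placeOf (pilotDataOfK D K) pp.1 x))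
  (tq : ∀ (pp : Nat.Primes) (x : (thetaIndex (pilotDataOfK D K)).Fibre (.inr pp)),
    haveI : Fact (pp : ℕ).Prime := ⟨pp.2⟩; kOf (pilotDataOfK D K) pp.1 x)
  (htq0 : ∀ pp x, tq pp x ≠ 0)
  (htq : ∀ (pp : Nat.Primes) (x : (thetaIndex (pilotDataOfK D K)).Fibre (.inr pp)),
    haveI : Fact (pp : ℕ).Prime := ⟨pp.2⟩
    Real.log ‖tq pp x‖ = -((pilotDataOfK D K).qPilot (placeOf (pilotDataOfK D K) pp.1 x)) *
      logNorm K (placeOf (pilotDataOfK D K) pp.1 x) / localDegree K (placeOf (pilotDataOfK D K) pp.1 x))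

include ht0 ht htq0 htq in
/-- **DATUM VERDICT AT `pilotDataOfK D K`, TAME CLOSED FORM**: at a bad place `x | p` of `K` with `p > 2`, `e_x ≤ p − 2`, all I06⋆ cells hold IFF
`(l⋇² − 1)·ord_x(q) ≤ 2l·(e_x − 1)` (`ord_x(q) = e(x|v)·ord_v(q_v)`, `ordq_pilotDataOfK`). [cite: Mochizuki2012, IUTchI Def. 3.1 (c) p. 61, Ex. 3.2 (iv) p. 71]
[cite: MochizukiAbsTopIII2015, Def 5.4 (iii) p. 126] -/
theorem allLabels_mem_iff_top_of_tame_pilotDataOfK (pp : Nat.Primes) [Fact (pp : ℕ).Prime] (hp : 2 < (pp : ℕ))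
    (x : (thetaIndex (pilotDataOfK D K)).Fibre (.inr pp)) (hx : placeOf (pilotDataOfK D K) pp.1 x ∈ (pilotDataOfK D K).S)
    (he : absRamificationIdx pp (kOf (pilotDataOfK D K) pp.1 x) ≤ pp - 2) :
    (∀ i : Fin (pilotDataOfK D K).lstar,
        tq pp x ∈ t pp i x • logShell (PadicLogOnUnits.ofUnitLog (pp : ℕ) (kOf (pilotDataOfK D K) pp.1 x))) ↔
      (((pilotDataOfK D K).lstar : ℤ) ^ 2 - 1) * (pilotDataOfK D K).ordq (placeOf (pilotDataOfK D K) pp.1 x) ≤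
        2 * l * (((placeOf (pilotDataOfK D K) pp.1 x).asIdeal.ramificationIdx ℤ : ℤ) - 1) := by
  rw [allLabels_mem_iff_top_of_tame (pilotDataOfK D K) t ht0 ht tq htq0 htq pp hp x hx he, pilotDataOfK_l]

include ht0 ht htq0 htq in
/-- **DATUM VERDICT AT `pilotDataOfK D K`, [IUTchIV]-regime NEG**: `8l·e_x·(b_{e_x} + c) < (l − 3)(l + 1)·ord_x(q)` at a bad place `x | p` ⟹ the
top-label cell fails, so the place's verdict is NEG. [cite: Mochizuki2012, IUTchI Ex. 3.2 (iv) p. 71; IUTchIV Thm. 1.10] [cite: MochizukiAbsTopIII2015, Def 5.4 (iii) p. 126] -/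
theorem exists_not_mem_pilotDataOfK_of_lt (pp : Nat.Primes) [Fact (pp : ℕ).Prime] (x : (thetaIndex (pilotDataOfK D K)).Fibre (.inr pp))
    (hx : placeOf (pilotDataOfK D K) pp.1 x ∈ (pilotDataOfK D K).S)
    (hlt : 8 * l * ((placeOf (pilotDataOfK D K) pp.1 x).asIdeal.ramificationIdx ℤ : ℝ) *
        (logRadiusB pp (absRamificationIdx pp (kOf (pilotDataOfK D K) pp.1 x)) + ((if (pp : ℕ) = 2 then 2 else 1 : ℕ) : ℝ)) <
      ((l : ℝ) - 3) * (l + 1) * ((pilotDataOfK D K).ordq (placeOf (pilotDataOfK D K) pp.1 x) : ℝ)) :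
    ∃ i : Fin (pilotDataOfK D K).lstar,
      tq pp x ∉ t pp i x • logShell (PadicLogOnUnits.ofUnitLog (pp : ℕ) (kOf (pilotDataOfK D K) pp.1 x)) := by
  refine exists_not_mem_of_lt (pilotDataOfK D K) t ht0 ht tq htq0 htq pp x hx ?_
  rw [pilotDataOfK_l]; exact_mod_cast hlt

end Genuine

/-! ## §4 (v2). INTEGER-FORM cells for the table's `d⁻` / `d⁺` columns (odd `p`) -/

section IntForms

open Thm311 Thm311.Real Cor312 Cor312Vol Cor312Prov

variable {F : Type} [Field F] [NumberField F] (X : PilotData F)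
  (t : ∀ (pp : Nat.Primes) (_ : Fin X.lstar) (x : (thetaIndex X).Fibre (.inr pp)),
    haveI : Fact (pp : ℕ).Prime := ⟨pp.2⟩; kOf X pp.1 x)
  (ht0 : ∀ pp i x, t pp i x ≠ 0)
  (ht : ∀ (pp : Nat.Primes) (i : Fin X.lstar) (x : (thetaIndex X).Fibre (.inr pp)),
    haveI : Fact (pp : ℕ).Prime := ⟨pp.2⟩
    Real.log ‖t pp i x‖ = -(X.thetaPilot i (placeOf X pp.1 x)) * logNorm F (placeOf X pp.1 x) /
      localDegree F (placeOf X pp.1 x))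
  (tq : ∀ (pp : Nat.Primes) (x : (thetaIndex X).Fibre (.inr pp)), haveI : Fact (pp : ℕ).Prime := ⟨pp.2⟩; kOf X pp.1 x)
  (htq0 : ∀ pp x, tq pp x ≠ 0)
  (htq : ∀ (pp : Nat.Primes) (x : (thetaIndex X).Fibre (.inr pp)),
    haveI : Fact (pp : ℕ).Prime := ⟨pp.2⟩
    Real.log ‖tq pp x‖ = -(X.qPilot (placeOf X pp.1 x)) * logNorm F (placeOf X pp.1 x) /
      localDegree F (placeOf X pp.1 x))

include ht0 ht htq0 htq in
/-- **POS CELL, INTEGER FORM (odd `p`)**: with `e = e_x` and `d⁻ := e − ⌈e/(p−2)⌉ = e − (e + p − 3)/(p − 2)` (ℕ-division; `c = 1`,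
`e·a_e = ⌈e/(p−2)⌉` by `logRadiusA_eq_ceilDiv`), `((i+1)² − 1)·ord_x(q) ≤ 2l·d⁻` ⟹ the cell holds — the table's «slack⁻ ≥ 0 ⇒ POS» in
`x`-units (`ord_x(q) = 2l·m_q`). [cite: Mochizuki2012, IUTchIV Prop. 1.2 (i) p. 10] [cite: MochizukiAbsTopIII2015, Def 5.4 (iii) p. 126] -/
theorem mem_of_int_slack_odd (pp : Nat.Primes) [Fact (pp : ℕ).Prime] (hp : 2 < (pp : ℕ)) (i : Fin X.lstar)
    (x : (thetaIndex X).Fibre (.inr pp)) (hx : placeOf X pp.1 x ∈ X.S)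
    (hle : ((((i : ℕ) : ℤ) + 1) ^ 2 - 1) * X.ordq (placeOf X pp.1 x) ≤
      2 * X.l * (((placeOf X pp.1 x).asIdeal.ramificationIdx ℤ : ℤ) -
        (((placeOf X pp.1 x).asIdeal.ramificationIdx ℤ + ((pp : ℕ) - 3)) / ((pp : ℕ) - 2) : ℕ))) :
    tq pp x ∈ t pp i x • logShell (PadicLogOnUnits.ofUnitLog (pp : ℕ) (kOf X pp.1 x)) := by
  refine qIdele_mem_thetaIdele_smul_logShell_of_le X t ht0 ht tq htq0 htq pp i x hx ?_
  have he1 : 1 ≤ (placeOf X pp.1 x).asIdeal.ramificationIdx ℤ := Ideal.ramificationIdx_pos _ _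
  have he0 : (0 : ℝ) < ((placeOf X pp.1 x).asIdeal.ramificationIdx ℤ : ℝ) := by exact_mod_cast he1
  have hA : logRadiusA pp (absRamificationIdx pp (kOf X pp.1 x)) =
      ((((placeOf X pp.1 x).asIdeal.ramificationIdx ℤ + ((pp : ℕ) - 3)) / ((pp : ℕ) - 2) : ℕ) : ℝ) /
        ((placeOf X pp.1 x).asIdeal.ramificationIdx ℤ : ℝ) := by
    rw [absRamificationIdx_rescaledCompletion F pp.1 (placeOf X pp.1 x) (natCast_mem_placeOf X pp.1 x), logRadiusA_eq_ceilDiv hp he1]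
  have hc : ((if (pp : ℕ) = 2 then 2 else 1 : ℕ) : ℝ) = 1 := by rw [if_neg (by omega)]; simp
  have hcast : ((((((i : ℕ) : ℤ) + 1) ^ 2 - 1) * X.ordq (placeOf X pp.1 x) : ℤ) : ℝ) ≤
      ((2 * X.l * (((placeOf X pp.1 x).asIdeal.ramificationIdx ℤ : ℤ) -
        (((placeOf X pp.1 x).asIdeal.ramificationIdx ℤ + ((pp : ℕ) - 3)) / ((pp : ℕ) - 2) : ℕ)) : ℤ) : ℝ) := by
    exact_mod_cast hle
  have e1 : ((((i : ℕ) : ℝ) + 1) ^ 2 - 1) * (X.ordq (placeOf X pp.1 x) : ℝ) =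
      ((((((i : ℕ) : ℤ) + 1) ^ 2 - 1) * X.ordq (placeOf X pp.1 x) : ℤ) : ℝ) := by push_cast; ring
  have e2 : 2 * X.l * ((placeOf X pp.1 x).asIdeal.ramificationIdx ℤ : ℝ) *
      (((if (pp : ℕ) = 2 then 2 else 1 : ℕ) : ℝ) - logRadiusA pp (absRamificationIdx pp (kOf X pp.1 x))) =
      ((2 * X.l * (((placeOf X pp.1 x).asIdeal.ramificationIdx ℤ : ℤ) -
        (((placeOf X pp.1 x).asIdeal.ramificationIdx ℤ + ((pp : ℕ) - 3)) / ((pp : ℕ) - 2) : ℕ)) : ℤ) : ℝ) := by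
    rw [hc, hA]
    simp only [Int.cast_mul, Int.cast_ofNat, Int.cast_sub, Int.cast_natCast]
    field_simp
  rw [e1, e2]
  exact hcast

include ht0 ht htq0 htq in
/-- **NEG CELL, INTEGER FORM (odd `p`, `e ≥ p − 1`)**: with `d⁺ := e·(Nat.log p (e/(p−1)) + 2) − 1` (`= e·⌊log_p(p·e/(p−1))⌋ − 1 + e`;
`e·b_e = e·(Nat.log p (e/(p−1)) + 1) − 1` by `logRadiusB_eq_natLog`, `c = 1`), `2l·d⁺ < ((i+1)² − 1)·ord_x(q)` ⟹ the cell FAILS — the table's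
«slack⁺ < 0 ⇒ NEG». (For `e ≤ p − 2` the tame closed form decides both ways.) [cite: Mochizuki2012, IUTchIV Prop. 1.2 (i) p. 10]
[cite: MochizukiAbsTopIII2015, Def 5.4 (iii) p. 126] -/
theorem not_mem_of_int_slack_odd (pp : Nat.Primes) [Fact (pp : ℕ).Prime] (hp : 2 < (pp : ℕ)) (i : Fin X.lstar)
    (x : (thetaIndex X).Fibre (.inr pp)) (hx : placeOf X pp.1 x ∈ X.S) (he : (pp : ℕ) - 1 ≤ (placeOf X pp.1 x).asIdeal.ramificationIdx ℤ)
    (hlt : 2 * X.l * (((placeOf X pp.1 x).asIdeal.ramificationIdx ℤ : ℤ) *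
        ((Nat.log (pp : ℕ) ((placeOf X pp.1 x).asIdeal.ramificationIdx ℤ / ((pp : ℕ) - 1)) + 2 : ℕ) : ℤ) - 1) <
      ((((i : ℕ) : ℤ) + 1) ^ 2 - 1) * X.ordq (placeOf X pp.1 x)) :
    tq pp x ∉ t pp i x • logShell (PadicLogOnUnits.ofUnitLog (pp : ℕ) (kOf X pp.1 x)) := by
  refine qIdele_not_mem_thetaIdele_smul_logShell_of_lt X t ht0 ht tq htq0 htq pp i x hx ?_
  have he1 : 1 ≤ (placeOf X pp.1 x).asIdeal.ramificationIdx ℤ := Ideal.ramificationIdx_pos _ _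
  have he0 : (0 : ℝ) < ((placeOf X pp.1 x).asIdeal.ramificationIdx ℤ : ℝ) := by exact_mod_cast he1
  have hB : logRadiusB pp (absRamificationIdx pp (kOf X pp.1 x)) =
      ((Nat.log (pp : ℕ) ((placeOf X pp.1 x).asIdeal.ramificationIdx ℤ / ((pp : ℕ) - 1)) + 1 : ℕ) : ℝ) -
        1 / ((placeOf X pp.1 x).asIdeal.ramificationIdx ℤ : ℝ) := by
    rw [absRamificationIdx_rescaledCompletion F pp.1 (placeOf X pp.1 x) (natCast_mem_placeOf X pp.1 x),
      logRadiusB_eq_natLog (lt_trans one_lt_two hp) he]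
  have hc : ((if (pp : ℕ) = 2 then 2 else 1 : ℕ) : ℝ) = 1 := by rw [if_neg (by omega)]; simp
  have hcast : ((2 * X.l * (((placeOf X pp.1 x).asIdeal.ramificationIdx ℤ : ℤ) *
        ((Nat.log (pp : ℕ) ((placeOf X pp.1 x).asIdeal.ramificationIdx ℤ / ((pp : ℕ) - 1)) + 2 : ℕ) : ℤ) - 1) : ℤ) : ℝ) <
      ((((((i : ℕ) : ℤ) + 1) ^ 2 - 1) * X.ordq (placeOf X pp.1 x) : ℤ) : ℝ) := by
    exact_mod_cast hlt
  have e1 : ((((i : ℕ) : ℝ) + 1) ^ 2 - 1) * (X.ordq (placeOf X pp.1 x) : ℝ) =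
      ((((((i : ℕ) : ℤ) + 1) ^ 2 - 1) * X.ordq (placeOf X pp.1 x) : ℤ) : ℝ) := by push_cast; ring
  have e2 : 2 * X.l * ((placeOf X pp.1 x).asIdeal.ramificationIdx ℤ : ℝ) *
      (logRadiusB pp (absRamificationIdx pp (kOf X pp.1 x)) + ((if (pp : ℕ) = 2 then 2 else 1 : ℕ) : ℝ)) =
      ((2 * X.l * (((placeOf X pp.1 x).asIdeal.ramificationIdx ℤ : ℤ) *
        ((Nat.log (pp : ℕ) ((placeOf X pp.1 x).asIdeal.ramificationIdx ℤ / ((pp : ℕ) - 1)) + 2 : ℕ) : ℤ) - 1) : ℤ) : ℝ) := by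
    rw [hc, hB]
    push_cast
    field_simp
    ring
  rw [e1, e2]
  exact hcast

end IntForms

end Summit.ABC.IUTFork.Repair.EvalI06StarGenuineDatum

end
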